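import Literature.AnabelianGeometry.AbsoluteAnabelian.AbsTopIII.Reconstruction
import Literature.AnabelianGeometry.AbsoluteAnabelian.FundamentalExtensionNonVacuity
import Literature.AnabelianGeometry.AbsoluteAnabelian.MLFGaloisTypeProofs
import Literature.AnabelianGeometry.AbsoluteAnabelian.SubpadicExamples
import HarnessLib

/-!
# [AbsTopIII] Thm. 1.9 / Cor. 1.10 (iii): the model-relative schemata `Thm_1_9 M`, `Cor_1_10_iii M`
# (FACT-LIST F-0399 / F-0396) have REFUTABLE universal closures

Mochizuki, *Topics in Absolute Anabelian Geometry III*, §1 Thm. 1.9 p. 37 ("there exists a functorial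
'group-theoretic' algorithm for reconstructing the 'NF-portion of the function field' of `X` from the
extension of profinite groups `1 → Δ_X → Π_X → G_k → 1`") and Cor. 1.10 (iii) p. 43 ("there exists a
functorial 'group-theoretic' algorithm for reconstructing the function field `K_X` of `X` from the
profinite group `Π_X`"), manuscript pagination (lit key `paper:url-5493eb38cbb7`).

Negative knowledge recorded next to `Reconstruction.lean` (abc-iut-L4-t1; FACT-LIST rows **F-0399**
`Thm_1_9`, **F-0396** `Cor_1_10_iii`, class `preparatory`, kernel-closedness `parametrised`), PROOF-ONLY
(no `def`, no `instance`, no `structure`; every countermodel is built inside a theorem term), abc-iut cell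
seat abc-iut-f-088 (F fact-proving wave, tranche 88).

Both rows are typed, deliberately (module docstring of `Reconstruction.lean`), as predicates ON A MODEL
`M : CurveModel` — the interface standing in for the étale `π₁` of hyperbolic orbicurves, NOT constructed in
the tree — and their comparison clauses mention model data that the record `CurveModel` does not tie to
the extension `M.ext X`: the closed points `M.Point X` with their decomposition groups `M.decomp X`
(Thm. 1.9 (a), Cor. 1.10 (iii)(e)) and the fields `M.NFFunctionField X`, `M.FunctionField X` (Thm. 1.9 (e),
Cor. 1.10 (iii)(h)).  An algorithm, however, sees ONLY `M.ext X`.  Hence two curves of a model with the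
SAME extension but different point data / non-isomorphic function fields defeat every algorithm, and the
R7 universal closures `∀ M, Thm_1_9 M`, `∀ M, Cor_1_10_iii M` are false:

* `Thm_1_9.exists_countermodel_decomp` — a model over the genuine MLF `ℚ₂` (sub-`2`-adic), every curve
  flagged "of strictly Belyi type", two curves sharing the point extension `Π = G = G_{ℚ₂}`, one with a
  single NF-point of decomposition group `Π`, one with no points: clause (a) forces `{Π} = ∅`;
* `Thm_1_9.exists_countermodel_functionField` — the same with NO points anywhere (so clause (a) is
  satisfiable) but "`K_{Z_NF}`" equal to `ℚ` on one curve and to `ℚ̄` on the other: clause (e) forces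
  `ℚ ≃+* ℚ̄`, impossible (`-1` is a square in `ℚ̄`, not in `ℚ`);
* `Cor_1_10_iii.exists_countermodel_decomp` — as the first, for clause (iii)(e) "the decomposition groups
  in `Π_X` of arbitrary closed points of `X`";
* the closures themselves: `not_forall_thm_1_9`, `not_forall_cor_1_10_iii` (universe `0`, which refutes
  the universe-polymorphic closure a fortiori).

READING (honest scope).  This refutes the UNIVERSAL CLOSURE over abstract models — the form rule R7 would
count as "the fact proved" — and nothing else: at the intended model (étale `π₁`, where the extension
determines the curve up to the indeterminacies the theorems allow) the rows are Mochizuki's theorems, whose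
content (Belyi cuspidalization, Kummer classes, Uchida's lemma) is far outside Mathlib; no consumer in the
tree binds either predicate at an instance today (`Summits/ABC/IUTFork/DAGL4p.lean` mentions the names
only).  So each row is admissible ONLY as the model-relative hypothesis `Thm_1_9 M` / `Cor_1_10_iii M` at a
coherent `M` (FACT-LIST class «universal-closure REFUTED / schema; instance forms open»), exactly like the
R5 rows F-0046 / F-0082 / F-0083.  By contrast the sibling rows F-0394 `Cor_1_10_i` (proved,
`AbsTopIII.cor_1_10_i_holds`) and F-0395 `Cor_1_10_ii` compare only data that `G_k` DOES determine (the
Frobenius quotient; `k^×` up to isomorphism), which is why their closures are provable and these are not.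
Nothing here bears on the disputed [IUTchIII] Cor. 3.12 or takes a side on any author; refuted-as-typed is a
statement about OUR typing, not about [AbsTopIII].
-/

noncomputable section

namespace Literature.AnabelianGeometry.AbsoluteAnabelian.AbsTopIII

open CategoryTheory

/-! ### Thm. 1.9, clause (a): decomposition groups of NF-points -/

/-- **F-0399, countermodel for clause (a).**  A `CurveModel` over the MLF `ℚ₂` all of whose curves are
Thm-1.9 inputs (strictly Belyi type flag, sub-`2`-adic base) and which violates `Thm_1_9`: the index type of
curves is `Type`, every curve has the point extension `Π = G_{ℚ₂}` and `M.Point U := U` with every point an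
NF-point of decomposition group `Π`; the (a)-clause at the curves `PUnit` and `PEmpty` then demands that
the ONE set `nfPointDecomp` of the algorithm's output on that extension be both `{Π}` and `∅`.
[cite: MochizukiAbsTopIII2015, Thm 1.9 (a) p.37] -/
theorem Thm_1_9.exists_countermodel_decomp :
    ∃ M : CurveModel.{0}, (∀ X : M.Curve, M.IsThm19Input X) ∧
      ¬ Literature.AnabelianGeometry.AbsoluteAnabelian.AbsTopIII.Thm_1_9 M := by
  classical
  haveI : Fact (Nat.Prime 2) := ⟨Nat.prime_two⟩
  let E₀ : FundamentalExtension.{0} :=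
    { arith := absoluteGaloisGrp ℚ_[2], gal := absoluteGaloisGrp ℚ_[2], aug := ContinuousMonoidHom.id _,
      aug_surjective := Function.surjective_id }
  obtain ⟨C₀⟩ := FundamentalExtension.CuspidalData.nonempty_cuspless E₀
  refine ⟨{ Curve := Type
            base := fun _ => ℚ_[2]
            ext := fun _ => E₀
            galIso := fun _ => Iso.refl _
            cusps := fun _ => C₀
            IsProper := fun _ => False
            IsScheme := fun _ => False
            genus := fun _ => 2
            FunctionField := fun _ => ℚ_[2]
            Point := fun U => U
            decomp := fun _ _ => ⊤
            IsNFCurve := fun _ => True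
            IsNFPoint := fun _ _ => True
            IsNFRational := fun _ _ => False
            IsNFConstant := fun _ _ => False
            NFFunctionField := fun _ => ℚ
            IsStrictlyBelyiType := fun _ => True
            IsCofiniteOpen := fun U U' => U = U'
            res := fun {U U'} _ => 𝟙 E₀ }, fun _ => ⟨trivial, IsSubpadic.of_isMLF (isMLF_padic 2)⟩, ?_⟩
  rintro ⟨A, hA⟩
  have h₁ := (hA PUnit ⟨trivial, IsSubpadic.of_isMLF (isMLF_padic 2)⟩).1
  have h₂ := (hA PEmpty ⟨trivial, IsSubpadic.of_isMLF (isMLF_padic 2)⟩).1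
  -- `Π = conj(1) • Π` lies in the first set, hence in the second, which is empty
  have hmem : (⊤ : Subgroup E₀.arith) ∈ (A.obj E₀).nfPointDecomp := by
    rw [h₁]
    exact ⟨PUnit.unit, 1, trivial, by rw [map_one, one_smul]⟩
  rw [h₂] at hmem
  obtain ⟨x, -⟩ := hmem
  exact x.elim

/-! ### Thm. 1.9, clause (e): the NF-function field -/

/-- **F-0399, countermodel for clause (e)** (no points anywhere, so clause (a) alone is satisfiable).  Index
type of curves `(K : Type) × Field K`, every curve over `ℚ₂` with the point extension `Π = G_{ℚ₂}` and
"`K_{Z_NF}` := `K`"; at the curves `⟨ℚ, _⟩` and `⟨ℚ̄, _⟩` clause (e) makes the algorithm's single output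
field isomorphic to both `ℚ` and `ℚ̄ = AlgebraicClosure ℚ` — but `-1` is a square in `ℚ̄` and not in `ℚ`.
[cite: MochizukiAbsTopIII2015, Thm 1.9 (e) p.38] -/
theorem Thm_1_9.exists_countermodel_functionField :
    ∃ M : CurveModel.{0}, (∀ X : M.Curve, M.IsThm19Input X) ∧ (∀ X : M.Curve, IsEmpty (M.Point X)) ∧
      ¬ Literature.AnabelianGeometry.AbsoluteAnabelian.AbsTopIII.Thm_1_9 M := by
  classical
  haveI : Fact (Nat.Prime 2) := ⟨Nat.prime_two⟩
  let E₀ : FundamentalExtension.{0} :=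
    { arith := absoluteGaloisGrp ℚ_[2], gal := absoluteGaloisGrp ℚ_[2], aug := ContinuousMonoidHom.id _,
      aug_surjective := Function.surjective_id }
  obtain ⟨C₀⟩ := FundamentalExtension.CuspidalData.nonempty_cuspless E₀
  refine ⟨{ Curve := (K : Type) × Field K
            base := fun _ => ℚ_[2]
            ext := fun _ => E₀
            galIso := fun _ => Iso.refl _
            cusps := fun _ => C₀
            IsProper := fun _ => False
            IsScheme := fun _ => False
            genus := fun _ => 2
            FunctionField := fun _ => ℚ_[2]
            Point := fun _ => PEmpty
            decomp := fun _ x => x.elim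
            IsNFCurve := fun _ => True
            IsNFPoint := fun _ x => x.elim
            IsNFRational := fun _ _ => False
            IsNFConstant := fun _ _ => False
            NFFunctionField := fun c => c.1
            instNFFunctionField := fun c => c.2
            IsStrictlyBelyiType := fun _ => True
            IsCofiniteOpen := fun U U' => U = U'
            res := fun {U U'} _ => 𝟙 E₀ }, fun _ => ⟨trivial, IsSubpadic.of_isMLF (isMLF_padic 2)⟩,
          fun _ => PEmpty.instIsEmpty, ?_⟩
  rintro ⟨A, hA⟩
  obtain ⟨e₁⟩ := (hA ⟨ℚ, inferInstance⟩ ⟨trivial, IsSubpadic.of_isMLF (isMLF_padic 2)⟩).2.2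
  obtain ⟨e₂⟩ := (hA ⟨AlgebraicClosure ℚ, inferInstance⟩ ⟨trivial, IsSubpadic.of_isMLF (isMLF_padic 2)⟩).2.2
  -- `e := e₁ ∘ e₂⁻¹ : ℚ̄ ≃+* ℚ`
  let e : AlgebraicClosure ℚ ≃+* ℚ := e₂.symm.trans e₁
  obtain ⟨z, hz⟩ := IsAlgClosed.exists_eq_mul_self (-1 : AlgebraicClosure ℚ)
  have h : (-1 : ℚ) = e z * e z := by
    rw [← map_mul, ← hz, map_neg, map_one]
  have : (0 : ℚ) ≤ e z * e z := mul_self_nonneg _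
  linarith

/-- **FACT-LIST F-0399, universal closure REFUTED** (at universe `0`; hence the universe-polymorphic R7
closure `∀ M : CurveModel.{u}, Thm_1_9 M` has no proof): witness `Thm_1_9.exists_countermodel_decomp`.
The instance form at a coherent model is untouched. [cite: MochizukiAbsTopIII2015, Thm 1.9 p.37] -/
theorem not_forall_thm_1_9 :
    ¬ ∀ M : CurveModel.{0}, Literature.AnabelianGeometry.AbsoluteAnabelian.AbsTopIII.Thm_1_9 M := by
  obtain ⟨M, -, hM⟩ := Thm_1_9.exists_countermodel_decomp
  exact fun h => hM (h M)

/-! ### Cor. 1.10 (iii), clause (e): decomposition groups of closed points -/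

/-- **F-0396, countermodel for clause (iii)(e).**  A `CurveModel` over the genuine MLF `ℚ₂` all of whose
curves are Cor-1.10 inputs of strictly Belyi type (flag) and which violates `Cor_1_10_iii`: index type of
curves `Type`, every curve with the point extension `Π = G_{ℚ₂}`, `M.Point U := U`, all decomposition
groups `Π`; clause (e) at the curves `PUnit` and `PEmpty` demands `closedPointDecomp` of the ONE output on
that extension to be both `{Π}` and `∅`. [cite: MochizukiAbsTopIII2015, Cor 1.10 (iii) p.43] -/
theorem Cor_1_10_iii.exists_countermodel_decomp :
    ∃ M : CurveModel.{0}, (∀ X : M.Curve, M.IsCor110Input X ∧ M.IsStrictlyBelyiType X) ∧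
      ¬ Literature.AnabelianGeometry.AbsoluteAnabelian.AbsTopIII.Cor_1_10_iii M := by
  classical
  haveI : Fact (Nat.Prime 2) := ⟨Nat.prime_two⟩
  let E₀ : FundamentalExtension.{0} :=
    { arith := absoluteGaloisGrp ℚ_[2], gal := absoluteGaloisGrp ℚ_[2], aug := ContinuousMonoidHom.id _,
      aug_surjective := Function.surjective_id }
  obtain ⟨C₀⟩ := FundamentalExtension.CuspidalData.nonempty_cuspless E₀
  refine ⟨{ Curve := Type
            base := fun _ => ℚ_[2]
            ext := fun _ => E₀
            galIso := fun _ => Iso.refl _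
            cusps := fun _ => C₀
            IsProper := fun _ => False
            IsScheme := fun _ => False
            genus := fun _ => 2
            FunctionField := fun _ => ℚ_[2]
            Point := fun U => U
            decomp := fun _ _ => ⊤
            IsNFCurve := fun _ => True
            IsNFPoint := fun _ _ => True
            IsNFRational := fun _ _ => False
            IsNFConstant := fun _ _ => False
            NFFunctionField := fun _ => ℚ
            IsStrictlyBelyiType := fun _ => True
            IsCofiniteOpen := fun U U' => U = U'
            res := fun {U U'} _ => 𝟙 E₀ }, fun _ => ⟨isMLF_padic 2, trivial⟩, ?_⟩
  rintro ⟨A, hA⟩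
  have h₁ := (hA PUnit (isMLF_padic 2) trivial).2
  have h₂ := (hA PEmpty (isMLF_padic 2) trivial).2
  have hmem : (⊤ : Subgroup E₀.arith) ∈ (A.obj E₀).closedPointDecomp := by
    rw [h₁]
    exact ⟨PUnit.unit, 1, by rw [map_one, one_smul]⟩
  rw [h₂] at hmem
  obtain ⟨x, -⟩ := hmem
  exact x.elim

/-- **FACT-LIST F-0396, universal closure REFUTED** (at universe `0`; hence the universe-polymorphic R7
closure `∀ M : CurveModel.{u}, Cor_1_10_iii M` has no proof): witness
`Cor_1_10_iii.exists_countermodel_decomp`.  The instance form at a coherent model — "Mochizuki's theorem"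
in the sense of Scholze–Stix, Thm. 7 — is untouched. [cite: MochizukiAbsTopIII2015, Cor 1.10 (iii) p.43] -/
theorem not_forall_cor_1_10_iii :
    ¬ ∀ M : CurveModel.{0}, Literature.AnabelianGeometry.AbsoluteAnabelian.AbsTopIII.Cor_1_10_iii M := by
  obtain ⟨M, -, hM⟩ := Cor_1_10_iii.exists_countermodel_decomp
  exact fun h => hM (h M)

end Literature.AnabelianGeometry.AbsoluteAnabelian.AbsTopIII

end
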